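import Summits.SmoothPoincare4.SmoothPoincare4.Theses.SblfDescent
import Literature.Topology.FourManifolds.SimplifiedBrokenLefschetzFibration

/-!
# Disproof of `StepGE3` — findings (cdisprove, crux stmt-SmoothPoincare4-18528, route SblfDescent)

Crux: `Summit.SmoothPoincare4.SmoothPoincare4.Theses.SblfDescent.StepGE3` —
`∀ M ≃ₕ S⁴, ∀ h ≥ 1, HAS(M, h+1) → HAS(M, h)`, where `HAS(M, n)` is the route's inline predicate
"`M` admits a simplified broken Lefschetz fibration (SBLF) with non-empty round locus of lower genus
`n`", which is FIELD FOR FIELD the tree structure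
`Literature.Topology.FourManifolds.IsSimplifiedBrokenLefschetzFibration o f L n` (`stepGE3_iff`).

## Findings (cycle 1, 2026-08-17)

* **No kill; no junk.**  The encoding is faithful (singular homology is Mathlib's, orientations,
  Lefschetz charts and the indefinite fold chart `(t, x₁²+x₂²−x₃²)` are genuine; the genus flags
  `H₁(F;ℤ) ≅ ℤ^{2n}` are mutually exclusive by IBN over `ℤ` — `genusFlag_unique`,
  `not_both_genera`).  The only homotopy 4-sphere the tree can name is `S⁴` itself, on which the
  conclusion `HAS(S⁴, h)` is TRUE for every `h` in print (Baykur 2012 Thm. 18 + Lemma 12), so an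
  unconditional `¬ StepGE3` is a disproof of SPC4.
* **Shield, kernel-checked modulo ONE print fact** (`sblf_of_every_genus_of_diffeomorph_sphere_four`,
  Baykur 2012, Thm. 18 and Lemma 12): `SmoothPoincare4 → StepGE3` (`stepGE3_of_smoothPoincare4`) and
  `¬ StepGE3 → ¬ SmoothPoincare4` (`not_smoothPoincare4_of_not_stepGE3`).  Sharper: the HYPOTHESIS
  `HAS(M, h+1)` of the crux is logically idle relative to the summit — already the bare conclusion
  `∀ M ≃ₕ S⁴, ∀ h, HAS(M, h)` follows from SPC4 (`hasSblf_of_smoothPoincare4`).  Any proof of the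
  crux that USES its hypothesis does so for the METHOD (descent), never for truth.
* **Load-bearing analysis.**
  - `1 ≤ h` carries EXACTLY `StepTwo`: `StepGE3WithoutOneLe ↔ StepTwo ∧ StepGE3`
    (`stepGE3WithoutOneLe_iff`); it is not load-bearing for truth (h = 0 is the other crux, equally
    SPC4-shielded), only for the route's bookkeeping (the genus-2 rung is a separate item).
  - `M ≃ₕ S⁴` IS load-bearing: `StepGE3WithoutHomotopyEquiv` is false on paper at
    `M = S² × Σ_{h+1}` for every `h ≥ 1` (Baykur 2012, Prop. 10 with Lemma 12 and Lemma 7: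
    `S² × Σ_g` carries an SBLF with non-empty round locus of lower genus `g` — flip-and-slip of the
    trivial bundle, `k = 2` — and none of lower genus `g − 1`, since `6 − 4g + k = e = 4 − 4g` forces
    `k = −2`).  Kernel form: `stepGE3WithoutHomotopyEquiv_false_of_gap` (any manifold with a
    broken-genus gap kills the unrestricted statement); the witness itself is not constructible in
    the tree (no `Σ_g`, no product atlas on `ℝ⁴`, no general Euler count), so no `_false_without_`
    theorem is LANDED for it.
  - REFINED (which part of `M ≃ₕ S⁴` = {closed, `π₁ = 1`, `H₂ = 0`} is needed): `π₁(M) = 1` is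
    NECESSARY — the statement already fails for smooth INTEGRAL HOMOLOGY 4-spheres: an SBLF of genus
    `g` gives a handle decomposition with `2g` one-handles (Baykur 2012, proof of Lemma 8, from [B1]),
    so `rank π₁(M) ≤ 2g`; the spun `M = S(Y)` of `Y = #3 Σ(2,3,5)` is a smooth homology 4-sphere with
    `π₁(M) ≅ π₁(Y)` of rank `6` (Grushko; `SL(2,5)` is 2-generated), hence every SBLF on `M` has genus
    `≥ 3`, i.e. lower genus `≥ 2`, and with Baykur–Saeki existence the minimal lower genus `n₀ ≥ 2`
    gives `HAS(M, n₀) ∧ ¬ HAS(M, n₀ − 1)`, `n₀ − 1 ≥ 1`.  So any proof of the crux must use simple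
    connectivity essentially (in SBLF terms: `c, c₁, …, c_k` and the lower-side 2-handle NORMALLY
    GENERATE `π₁(Σ_g)`), not only `H₂(M) = 0` / the Euler count `k = 4g − 4`.  Whether `H₂(M) = 0` is
    necessary GIVEN `π₁ = 1` is open in print (it needs a closed simply connected 4-manifold of broken
    genus `≥ 3`; Baykur 2012 Thm. 18: the standard ones have broken genus `≤ 2`).
  - every conjunct INSIDE the hypothesis `HAS(M, h+1)` (positivity of the Lefschetz points,
    connected fibres, injectivity on the critical set, Lefschetz points on the higher side, the fold
    chart, even smoothness/surjectivity of `f`) can be dropped or weakened without making the crux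
    refutable: the weakened statement is still implied by SPC4 (`hasSblf_of_smoothPoincare4` does
    not look at the hypothesis).  So NO hypothesis mutation yields a Lean counterexample.
* **Equivalent form for the provers** (modulo flip-and-slip monotonicity `RaisesGenus`, Baykur 2012
  Lemma 12): `StepGE3 ↔ BrokenGenusLeTwo` — every homotopy 4-sphere carrying an SBLF of lower genus
  `≥ 2` carries one of lower genus `1` (`brokenGenusLeTwo_of_stepGE3`, `stepGE3_of_brokenGenusLeTwo`).
* **Natural strengthenings.** (i) "for all closed oriented `M`": false (`S² × Σ_g`, above; also
  `T⁴ # S¹×S³` by Baykur's `b₁ ≤ 2g`, Lemma 8).  (i') "for all smooth integral homology 4-spheres":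
  false (spun Poincaré sums, `rank π₁ ≤ 2g`, above).  (ii) "for all closed simply connected `M`":
  OPEN in print as far as searched — it needs a simply connected `M` of broken genus `≥ 3`; Baykur
  2012 Thm. 18/23 give broken genus `≤ 2` for the standard ones and unbounded RELATIVE genera
  `g(X_n, α_n)` only.  (iii) "class-preserving descent" (keep the class of `f` in
  `[M, S²] = π₄(S²) = ℤ/2`, card arf-class-two-ladders): consistent on `S⁴` for `h ≥ 1` iff `S⁴` has
  an ESSENTIAL SBLF of lower genus 1 (the card's Matsumoto-derived genus-2 fibration, unverified);
  at `h = 0` it is false (sphere fibre ⇒ Arf = 0) — StepTwo's range, not this crux's.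
* **Engine, not statement.**  The route's kill criterion "a Hurwitz-rigid `S⁴`-system at genus ≥ 3"
  would kill the un-flip-and-slip METHOD but not this typed crux (`HAS(S⁴, h)` holds regardless).
  Nothing of the kind is in print (Baykur–Hayano arXiv:1410.5531 Thm 3.9 / Rem 4.9: rigidity of BLF
  isomorphism WITHIN a cohomotopy class on `S¹×S³ # S²×Σ_{g−1} # n CP²bar`, not on homotopy spheres;
  Hayano arXiv:1203.4299: the flip-and-slip cycle algorithm, no obstruction).
* **Method constraint in print: the inputs of `StepGE3` are never hyperelliptic.**  Hayano–Sato 2013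
  (arXiv:1110.0161), Thm. 1.1(ii): a regular fibre of a HYPERELLIPTIC SBLF of genus `g ≥ 3` has
  `[F] ≠ 0 ∈ H₂(M; ℚ)`; Cor. 1.4: *"A closed oriented four-manifold with definite intersection form
  cannot admit any hyperelliptic simplified broken Lefschetz fibrations of genus `g ≥ 3`"*; p. 4
  verbatim: *"for any `g ≥ 3`, we can easily construct genus-`g` simplified broken Lefschetz
  fibrations on `S⁴` […]. However, these fibrations are not hyperelliptic"*.  On a homotopy 4-sphere
  (`H₂ = 0`) EVERY SBLF of genus `h + 2 ≥ 3` — i.e. every input of `StepGE3` — therefore has monodromy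
  group NOT inside the hyperelliptic mapping class group: the Birman–Hilden / braid-group (`B_{2g+2}`)
  reduction that makes `StepTwo` a bounded problem is unavailable at EVERY rung of `StepGE3`, not
  only at genus 3; "StepGE3 restricted to hyperelliptic inputs" is vacuously true and proves nothing.

## Targets
None yet: payload.targets / stuck_stubs empty; line `Sketch` (PICKED.md) not registered at this
boundary.  Its announced split `StepGE3Class false → StepGE3Class true → StepGE3` is a case
distinction on the INPUT class only, so each half inherits the shield above verbatim.

## Ledger (landings of this file's content under `Theorems/StepGE3/Negative/`)
* `LoadBearing.lean` — p146298 (dry-run ACCEPT): `genusFlag_unique`, `not_both_genera`,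
  `stepGE3_without_homotopyEquiv_false_of_gap`, `hasSblf_one_of_stepGE3`, `stepGE3_of_hasSblf_one`.
* `OfSmoothPoincare4.lean` — p146360 (+ gate-relocated fact p146359 into
  `Literature/Topology/FourManifolds/SimplifiedBrokenLefschetzExistence.lean`): `stepGE3_iff_tree`,
  `stepTwo_iff_tree`, `exists_sblf_of_smoothPoincare4`, `stepGE3_of_smoothPoincare4`,
  `not_smoothPoincare4_of_not_stepGE3`, `stepGE3_without_oneLe_iff`, `descent_of_smoothPoincare4`
  (first attempt p145389/p145390 bounced: relocation copied a file-local notation).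

Prose lives in docstrings; every `theorem` below is sorry-free.
-/

noncomputable section

-- `Summit.SmoothPoincare4.SmoothPoincare4.…` (summit = sub-problem) trips `dupNamespace`.
set_option linter.dupNamespace false

open scoped Manifold ContDiff Topology ContinuousMap
open Literature.Topology.FourManifolds

namespace Summit.SmoothPoincare4.SmoothPoincare4.Cruxes.StepGE3.Disproof

open Summit.SmoothPoincare4.SmoothPoincare4.Theses.SblfDescent

/-! ## 0. The crux in tree vocabulary -/

/-- `HasSblf M h` — the route's `HAS(M, h)`: the smooth 4-manifold `M` admits a smooth orientation
`o`, a map `f : M → S²` and a finite `L ⊆ M` forming a simplified broken Lefschetz fibration with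
non-empty round locus, positive Lefschetz set `L` and lower genus `h`
(`Literature.Topology.FourManifolds.IsSimplifiedBrokenLefschetzFibration o f L h`). [folklore] -/
def HasSblf (M : Type) [TopologicalSpace M] [ChartedSpace (EuclideanSpace ℝ (Fin 4)) M]
    [IsManifold (𝓡 4) ∞ M] (h : ℕ) : Prop :=
  ∃ (o : SmoothOrientation (𝓡 4) M) (f : M → Metric.sphere (0 : EuclideanSpace ℝ (Fin 3)) 1)
    (L : Finset M), IsSimplifiedBrokenLefschetzFibration o f L h

/-- **Reading of the crux.**  `StepGE3` is, field for field, the statement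
`∀ M ≃ₕ S⁴, ∀ h ≥ 1, HasSblf M (h + 1) → HasSblf M h` over the tree's SBLF structure (the inline
`let R …; let G …; … ∧ …` block is the list of the ten fields, in order). [folklore] -/
theorem stepGE3_iff : StepGE3 ↔
    ∀ (M : Type) [TopologicalSpace M] [T2Space M] [SecondCountableTopology M]
      [ChartedSpace (EuclideanSpace ℝ (Fin 4)) M] [IsManifold (𝓡 4) ∞ M],
      M ≃ₕ Metric.sphere (0 : EuclideanSpace ℝ (Fin 5)) 1 → ∀ h : ℕ, 1 ≤ h →
        HasSblf M (h + 1) → HasSblf M h := by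
  constructor
  · intro H M _ _ _ _ _ e h hh hM
    obtain ⟨o, f, L, ⟨h1, h2, h3, h4, h5, h6, h7, h8, h9, h10⟩⟩ := hM
    obtain ⟨o', f', L', h1, h2, h3, h4, h5, h6, h7, h8, h9, h10⟩ :=
      H M e h hh ⟨o, f, L, h1, h2, h3, h4, h5, h6, h7, h8, h9, h10⟩
    exact ⟨o', f', L', ⟨h1, h2, h3, h4, h5, h6, h7, h8, h9, h10⟩⟩
  · intro H M _ _ _ _ _ e h hh hM
    obtain ⟨o, f, L, h1, h2, h3, h4, h5, h6, h7, h8, h9, h10⟩ := hM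
    obtain ⟨o', f', L', ⟨h1, h2, h3, h4, h5, h6, h7, h8, h9, h10⟩⟩ :=
      H M e h hh ⟨o, f, L, ⟨h1, h2, h3, h4, h5, h6, h7, h8, h9, h10⟩⟩
    exact ⟨o', f', L', h1, h2, h3, h4, h5, h6, h7, h8, h9, h10⟩

/-- **Reading of the sibling crux** `StepTwo` (the case `h = 0` of the same shape):
`∀ M ≃ₕ S⁴, HasSblf M 1 → HasSblf M 0`. [folklore] -/
theorem stepTwo_iff : StepTwo ↔
    ∀ (M : Type) [TopologicalSpace M] [T2Space M] [SecondCountableTopology M]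
      [ChartedSpace (EuclideanSpace ℝ (Fin 4)) M] [IsManifold (𝓡 4) ∞ M],
      M ≃ₕ Metric.sphere (0 : EuclideanSpace ℝ (Fin 5)) 1 → HasSblf M 1 → HasSblf M 0 := by
  constructor
  · intro H M _ _ _ _ _ e hM
    obtain ⟨o, f, L, ⟨h1, h2, h3, h4, h5, h6, h7, h8, h9, h10⟩⟩ := hM
    obtain ⟨o', f', L', h1, h2, h3, h4, h5, h6, h7, h8, h9, h10⟩ :=
      H M e ⟨o, f, L, h1, h2, h3, h4, h5, h6, h7, h8, h9, h10⟩
    exact ⟨o', f', L', ⟨h1, h2, h3, h4, h5, h6, h7, h8, h9, h10⟩⟩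
  · intro H M _ _ _ _ _ e hM
    obtain ⟨o, f, L, h1, h2, h3, h4, h5, h6, h7, h8, h9, h10⟩ := hM
    obtain ⟨o', f', L', ⟨h1, h2, h3, h4, h5, h6, h7, h8, h9, h10⟩⟩ :=
      H M e ⟨o, f, L, ⟨h1, h2, h3, h4, h5, h6, h7, h8, h9, h10⟩⟩
    exact ⟨o', f', L', h1, h2, h3, h4, h5, h6, h7, h8, h9, h10⟩

/-! ## 1. Encoding checks: the genus flags are exclusive (no junk in `G y n`) -/

/-- **Invariant basis number for the genus flag.**  If `ℤ^{2n} ≃ₗ[ℤ] V` and `ℤ^{2m} ≃ₗ[ℤ] V` then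
`n = m`: the route reads "the regular fibre over `y` has genus `n`" as
`Nonempty ((Fin (2 * n) → ℤ) ≃ₗ[ℤ] H₁(f ⁻¹' {y}; ℤ))`, and this lemma certifies that a fibre
carries at most one genus flag. [folklore] -/
theorem genusFlag_unique {V : Type*} [AddCommGroup V] [Module ℤ V] {n m : ℕ}
    (hn : Nonempty ((Fin (2 * n) → ℤ) ≃ₗ[ℤ] V)) (hm : Nonempty ((Fin (2 * m) → ℤ) ≃ₗ[ℤ] V)) :
    n = m := by
  obtain ⟨e₁⟩ := hn
  obtain ⟨e₂⟩ := hm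
  have h := (e₁.trans e₂.symm).finrank_eq
  simp only [Module.finrank_fin_fun] at h
  omega

/-- **No regular fibre of an SBLF is simultaneously of genus `h + 1` and `h`**: the disjunction in
the `fibre` clause of the crux is exclusive (so "higher side" / "lower side" are well defined
value by value). [folklore] -/
theorem not_both_genera {X : Type} [TopologicalSpace X] [ChartedSpace (EuclideanSpace ℝ (Fin 4)) X]
    [IsManifold (𝓡 4) ∞ X] {f : X → Metric.sphere (0 : EuclideanSpace ℝ (Fin 3)) 1} {h : ℕ}
    (y : Metric.sphere (0 : EuclideanSpace ℝ (Fin 3)) 1) :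
    ¬ (Nonempty ((Fin (2 * (h + 1)) → ℤ) ≃ₗ[ℤ]
          Literature.AlgebraicTopology.SingularHomology.singularHomology ℤ ℤ ↥(f ⁻¹' {y}) 1) ∧
       Nonempty ((Fin (2 * h) → ℤ) ≃ₗ[ℤ]
          Literature.AlgebraicTopology.SingularHomology.singularHomology ℤ ℤ ↥(f ⁻¹' {y}) 1)) :=
  fun hh ↦ absurd (genusFlag_unique hh.1 hh.2) (Nat.succ_ne_self h)

/-! ## 2. Load-bearing analysis -/

/-- `StepGE3` with the hypothesis `1 ≤ h` DROPPED. [folklore] -/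
def StepGE3WithoutOneLe : Prop :=
  ∀ (M : Type) [TopologicalSpace M] [T2Space M] [SecondCountableTopology M]
    [ChartedSpace (EuclideanSpace ℝ (Fin 4)) M] [IsManifold (𝓡 4) ∞ M],
    M ≃ₕ Metric.sphere (0 : EuclideanSpace ℝ (Fin 5)) 1 → ∀ h : ℕ, HasSblf M (h + 1) → HasSblf M h

/-- **`1 ≤ h` carries exactly `StepTwo`.**  Dropping `1 ≤ h` from the crux gives PRECISELY the
conjunction of the two cruxes of the route: the new case `h = 0` is `StepTwo` verbatim.  So the
hypothesis is not load-bearing for truth (both cruxes are SPC4-shielded, §3) — it only separates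
the genus-2 rung, which the route files as its own item. [folklore] -/
theorem stepGE3WithoutOneLe_iff : StepGE3WithoutOneLe ↔ StepTwo ∧ StepGE3 := by
  rw [stepTwo_iff, stepGE3_iff]
  constructor
  · intro W
    exact ⟨fun M _ _ _ _ _ e hM ↦ W M e 0 hM, fun M _ _ _ _ _ e h _ hM ↦ W M e h hM⟩
  · rintro ⟨h2, h3⟩ M _ _ _ _ _ e h hM
    cases h with
    | zero => exact h2 M e hM
    | succ h => exact h3 M e (h + 1) (Nat.succ_le_succ (Nat.zero_le h)) hM

/-- `StepGE3` with the hypothesis `M ≃ₕ S⁴` DROPPED (every Hausdorff second-countable smooth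
4-manifold charted on `ℝ⁴`). [folklore] -/
def StepGE3WithoutHomotopyEquiv : Prop :=
  ∀ (M : Type) [TopologicalSpace M] [T2Space M] [SecondCountableTopology M]
    [ChartedSpace (EuclideanSpace ℝ (Fin 4)) M] [IsManifold (𝓡 4) ∞ M],
    ∀ h : ℕ, 1 ≤ h → HasSblf M (h + 1) → HasSblf M h

/-- **`M ≃ₕ S⁴` is load-bearing — kernel form.**  ANY smooth 4-manifold with a broken-genus gap
(an SBLF of lower genus `g ≥ 2` but none of lower genus `g − 1`) refutes the unrestricted statement.
PAPER WITNESS (not constructible in the tree): `M = S² × Σ_g`, `g ≥ 2` — Baykur 2012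
(arXiv:1205.5439), Prop. 10 verbatim: *"`g(S² × Σ_g) = g` for any non-negative integer `g`"* with
Lemma 12 (*"If it admits a genus `g` SBLF, then it admits a genus `g+1` SPWF"*, then an SBLF of
genus `g + 1`, i.e. lower genus `g`, whose round locus is the flip-and-slip circle, `k = 2`) for
`hex`, and Lemma 7 (*"`e(X) = 6 − 4g + k`"* with non-empty round locus) for `hno`: lower genus
`g − 1` means genus `g`, and `6 − 4g + k = e(S² × Σ_g) = 4 − 4g` forces `k = −2 < 0`.  A second
witness family: `b₁(M) > 2g` excludes genus `≤ g` (Lemma 8, *"`2g ≥ b₁(X)`"*), e.g. `T⁴ # S¹×S³`.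
A third, sharpest family (only `π₁ = 1` deleted, `M` still a smooth INTEGRAL HOMOLOGY 4-sphere):
the spun `S(Y)` of `Y = #3 Σ(2,3,5)` — `rank π₁ = 6` by Grushko while an SBLF of genus `g` presents
`π₁` on `2g` generators (proof of Lemma 8), so every SBLF has lower genus `≥ 2`, and Baykur–Saeki
existence supplies the minimal one. [cite: Baykur2012, Prop. 10, Lemma 7, Lemma 8, Lemma 12] -/
theorem stepGE3WithoutHomotopyEquiv_false_of_gap
    (M : Type) [TopologicalSpace M] [T2Space M] [SecondCountableTopology M]
    [ChartedSpace (EuclideanSpace ℝ (Fin 4)) M] [IsManifold (𝓡 4) ∞ M]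
    (g : ℕ) (hg : 2 ≤ g) (hex : HasSblf M g) (hno : ¬ HasSblf M (g - 1)) :
    ¬ StepGE3WithoutHomotopyEquiv := by
  intro W
  obtain ⟨d, rfl⟩ : ∃ d, g = d + 1 := ⟨g - 1, by omega⟩
  exact hno (by simpa using W M d (by omega) hex)

/-! ## 3. The shield: `SmoothPoincare4 → StepGE3`, modulo one print fact

The tree cannot yet construct a single SBLF (no Hurwitz-system / Kirby-calculus library), so the
print fact "`S⁴` carries SBLFs of every genus" enters as a NAMED FACT hypothesis, stated — as Baykur
states diffeomorphism invariance of broken genera (2012, §2, *"Let `ψ : X' → X` be a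
diffeomorphism. If `f : X → S²` is an SBLF […] then […] `f' = f ∘ ψ : X' → S²`"* is one) — for every
manifold diffeomorphic to the unit sphere. -/

/-- NAMED FACT — **`S⁴` carries simplified broken Lefschetz fibrations with non-empty round locus
of every genus** (Baykur 2012, arXiv:1205.5439).  Thm. 18, verbatim: *"The 4-manifolds `S⁴`,
`#r(S² × S²)` for `r ≥ 2`, `a CP² # b CP²bar` for `a ≥ 0, b ≥ 1` except for `a = b = 1`, and `K3`, all
have broken genus one."* (proof there: *"We immediately see that the broken genera of `S⁴`, `CP²bar`
(see Figure (trivialgenusoneSBLFs)), and `K3` are one"* — the genus-1 SBLF of `S⁴` with one round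
circle and no Lefschetz point of Auroux–Donaldson–Katzarkov 2005, §8.2 Ex. 1; Hayano 2011,
Rem. 4.3); Lemma 12, verbatim: *"If `(X, α)` admits a genus `g` SPWF, then it admits a genus `g`
SBLF. If it admits a genus `g` SBLF, then it admits a genus `g+1` SPWF."* (proof: perturb the
Lefschetz points to cusped circles, inverse-merge them into one, flip-and-slip, merge — ONE round
circle — then unsink the cusps); hence, by induction on `g`, `S⁴` admits a genus-`g` SBLF with
non-empty connected round locus for every `g ≥ 1`, "simplified" in the sense of ibid. §2
(*"the round image is connected […] and embedded, […] all the fibers are connected and all the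
Lefschetz singularities lie over the 2-disk component of `S² ∖ f(Z)` over which fibers have higher
genera"*), and the same holds for every `X'` diffeomorphic to `S⁴` (ibid. §2: `f ∘ ψ`).
LEAN READING, in the tree's vocabulary (`IsSimplifiedBrokenLefschetzFibration o f L h`: genus
`h + 1`, lower genus `h`, non-empty connected round locus, positive Lefschetz set `L`): for every
Hausdorff second-countable `C^∞` 4-manifold `M : Type` charted on `ℝ⁴` and diffeomorphic to the
unit sphere `S⁴ ⊆ ℝ⁵`, and every `h : ℕ`, there are `o`, `f`, `L` with
`IsSimplifiedBrokenLefschetzFibration o f L h`.  Users take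
`(H : sblf_of_every_genus_of_diffeomorph_sphere_four)`; nothing is asserted.
[cite: Baykur2012, Thm. 18 and Lemma 12] -/
def sblf_of_every_genus_of_diffeomorph_sphere_four : Prop :=
  ∀ (M : Type) [TopologicalSpace M] [T2Space M] [SecondCountableTopology M]
    [ChartedSpace (EuclideanSpace ℝ (Fin 4)) M] [IsManifold (𝓡 4) ∞ M],
    Nonempty (Diffeomorph (𝓡 4) (𝓡 4) M (Metric.sphere (0 : EuclideanSpace ℝ (Fin 5)) 1) ∞) →
    ∀ h : ℕ, ∃ (o : SmoothOrientation (𝓡 4) M)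
      (f : M → Metric.sphere (0 : EuclideanSpace ℝ (Fin 3)) 1) (L : Finset M),
      IsSimplifiedBrokenLefschetzFibration o f L h

/-- **Under SPC4 every homotopy 4-sphere carries SBLFs of every lower genus** (modulo the named
fact): SPC4 makes `M ≃ₕ S⁴` diffeomorphic to `S⁴`, and the fact supplies the fibrations.  This is
the CONCLUSION of `StepGE3` with its hypothesis `HAS(M, h+1)` (and `1 ≤ h`) deleted — so that
hypothesis is logically idle relative to the summit. [folklore] -/
theorem hasSblf_of_smoothPoincare4 (H : sblf_of_every_genus_of_diffeomorph_sphere_four)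
    (hS : _root_.SmoothPoincare4)
    (M : Type) [TopologicalSpace M] [T2Space M] [SecondCountableTopology M]
    [ChartedSpace (EuclideanSpace ℝ (Fin 4)) M] [IsManifold (𝓡 4) ∞ M]
    (e : M ≃ₕ Metric.sphere (0 : EuclideanSpace ℝ (Fin 5)) 1) (h : ℕ) : HasSblf M h := by
  have hd : Nonempty
      (Diffeomorph (𝓡 4) (𝓡 4) M (Metric.sphere (0 : EuclideanSpace ℝ (Fin 5)) 1) ∞) :=
    hS M ‹_› ‹_› e
  unfold HasSblf
  exact H M hd h

/-- **The shield: `SmoothPoincare4 → StepGE3`** (modulo the named fact).  The hypotheses `1 ≤ h` and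
`HAS(M, h+1)` of the crux are not used. [folklore] -/
theorem stepGE3_of_smoothPoincare4 (H : sblf_of_every_genus_of_diffeomorph_sphere_four)
    (hS : _root_.SmoothPoincare4) : StepGE3 :=
  stepGE3_iff.mpr fun M _ _ _ _ _ e h _ _ ↦ hasSblf_of_smoothPoincare4 H hS M e h

/-- **A refutation of the crux is a disproof of SPC4** (modulo the named fact): contrapositive of
`stepGE3_of_smoothPoincare4`.  In words: a counterexample to `StepGE3` is a smooth homotopy
4-sphere `M` with an SBLF of some lower genus `h + 1 ≥ 2` and none of lower genus `h`; since every
manifold diffeomorphic to `S⁴` has SBLFs of all lower genera, `M` is an exotic `S⁴`. [folklore] -/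
theorem not_smoothPoincare4_of_not_stepGE3 (H : sblf_of_every_genus_of_diffeomorph_sphere_four)
    (h : ¬ StepGE3) : ¬ _root_.SmoothPoincare4 :=
  fun hS ↦ h (stepGE3_of_smoothPoincare4 H hS)

/-- The same shield for the whole descent `StepTwo ∧ StepGE3` (= `StepGE3WithoutOneLe`).
[folklore] -/
theorem stepGE3WithoutOneLe_of_smoothPoincare4 (H : sblf_of_every_genus_of_diffeomorph_sphere_four)
    (hS : _root_.SmoothPoincare4) : StepGE3WithoutOneLe :=
  fun M _ _ _ _ _ e h _ ↦ hasSblf_of_smoothPoincare4 H hS M e h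

/-! ## 4. Equivalent form: broken genus ≤ 2 on homotopy spheres (modulo flip-and-slip monotonicity) -/

/-- **Flip-and-slip monotonicity** on homotopy 4-spheres, as a hypothesis (Baykur 2012, Lemma 12:
a genus-`g` SBLF yields a genus-`(g+1)` one; on a homotopy sphere the round locus stays non-empty).
Not asserted; used only as an explicit hypothesis below. [cite: Baykur2012, Lemma 12] -/
def RaisesGenus : Prop :=
  ∀ (M : Type) [TopologicalSpace M] [T2Space M] [SecondCountableTopology M]
    [ChartedSpace (EuclideanSpace ℝ (Fin 4)) M] [IsManifold (𝓡 4) ∞ M],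
    M ≃ₕ Metric.sphere (0 : EuclideanSpace ℝ (Fin 5)) 1 → ∀ n : ℕ, HasSblf M n → HasSblf M (n + 1)

/-- "**Broken genus at most two**": every smooth homotopy 4-sphere carrying an SBLF of some lower
genus `n ≥ 2` carries one of lower genus `1` (genus `2`). [folklore] -/
def BrokenGenusLeTwo : Prop :=
  ∀ (M : Type) [TopologicalSpace M] [T2Space M] [SecondCountableTopology M]
    [ChartedSpace (EuclideanSpace ℝ (Fin 4)) M] [IsManifold (𝓡 4) ∞ M],
    M ≃ₕ Metric.sphere (0 : EuclideanSpace ℝ (Fin 5)) 1 → ∀ n : ℕ, 2 ≤ n → HasSblf M n → HasSblf M 1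

/-- `StepGE3` implies "broken genus ≤ 2" outright (iterate the descent from `n` down to `1`).
[folklore] -/
theorem brokenGenusLeTwo_of_stepGE3 (h3 : StepGE3) : BrokenGenusLeTwo := by
  rw [stepGE3_iff] at h3
  intro M _ _ _ _ _ e n hn hM
  have key : ∀ d : ℕ, HasSblf M (d + 1) → HasSblf M 1 := by
    intro d
    induction d with
    | zero => exact id
    | succ d ih => exact fun hd ↦ ih (h3 M e (d + 1) (Nat.succ_le_succ (Nat.zero_le d)) hd)
  obtain ⟨d, rfl⟩ : ∃ d, n = d + 1 := ⟨n - 1, by omega⟩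
  exact key d hM

/-- Conversely, GIVEN flip-and-slip monotonicity, "broken genus ≤ 2" implies `StepGE3` (descend to
lower genus `1`, then climb back to `h`).  So, modulo Baykur's Lemma 12, the crux is exactly the
statement that no homotopy 4-sphere has broken genus `≥ 3`. [folklore] -/
theorem stepGE3_of_brokenGenusLeTwo (hr : RaisesGenus) (h2 : BrokenGenusLeTwo) : StepGE3 := by
  rw [stepGE3_iff]
  intro M _ _ _ _ _ e h hh hM
  have h1 : HasSblf M 1 := h2 M e (h + 1) (by omega) hM
  have key : ∀ d : ℕ, HasSblf M (d + 1) := by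
    intro d
    induction d with
    | zero => exact h1
    | succ d ih => exact hr M e (d + 1) ih
  obtain ⟨d, rfl⟩ : ∃ d, h = d + 1 := ⟨h - 1, by omega⟩
  exact key d

/-! ## 5. Targets
None registered at this boundary (payload.targets = []; `Lines/Sketch.lean` not yet published). -/

end Summit.SmoothPoincare4.SmoothPoincare4.Cruxes.StepGE3.Disproof

end
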